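import Summits.QuantumFields.YangMills.Theorems.UnitScaleTiltProp7PinnedKernelL1
import Summits.QuantumFields.YangMills.Theorems.UnitScaleTiltProp7PinnedKernelL1ExplicitNoWrap
import HarnessLib

/-!
# Route `UnitScaleTilt`, crux K1 «MinimiserStabilityRegPr» (stmt-QuantumFields-19200), route-R E′ path (α′), residue (hK) — THE KERNEL BOUND WITHOUT THE TORUS-SIZE FLOOR:
# ★★★ `exists_green_kernel_l1_le'` = ✓p669951 `Prop7PinnedKernelL1.exists_green_kernel_l1_le` with the hypothesis `40 ≤ sitesPerDir k` DELETED — `∃ Φ, ∀ P (d = 3) k (1 ≤ k ≤ m+K)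
# c ≠ 0 V, ∃ G, hG0 ∧ hGrep ∧ ∀ b, Σ_z|c·(Δ_c(G b₊) − Δ_c(G b₋))(z)| ≤ Φ·L^k∕|c|` — so the SMALL-TORUS BRANCH (`L^{m+n} < 20`: top levels of small-`m` families, every `K`)
# located by ★routeR-w3 g6 (22:35:16Z) is covered and ✓p671212 (S2-FLAT-CLOSE) ∕ ✓p672075 ∕ the (E1-b) flat rows can be re-cut without the floor

Cell `ym3-torus`, width seat `ym3-torus-px22` (gen 2), on ★routeR-w3 g6's NAMER WORD (13) «px22 g2: (hK)-NOWRAP GO now».  `--supports stmt-QuantumFields-19200`, count-neutral.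
THEOREMS ONLY (0 `def`, 0 `sorry`).  YM₃ on T³ is a ladder rung (R3), not the Clay problem; nothing here claims the stub, the crux, d = 4 or the gap.

HOW.  The floor entered ✓p669951 only through the near-field count (✓ `near_radius_lt` ⇒ `2⌈5√d·2ℓ⌉₊ < L^k·sitesPerDir k` for px4∕px7's no-wrap ball sum); ✓ `Prop7PinnedKernelNearFieldNoWrap`
counts in the torus metric instead (uniform pole bound + `tdist⁻²` layer cake, any torus size), ✓ `Prop7PinnedKernelL1ExplicitNoWrap.sum_abs_laplace_kernel_le_explicit'` is ✓p667471 with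
that one brick swapped, and this file is ✓p669951's final assembly verbatim over it (`kappa0_rows`, `rep_real_of_rep`, `abs_torusGreen2_grad_le_of_eq`, ✓ `explicit_le_linear` reused by name).

WHAT IS PROVED (ns `…Theorems.Prop7PinnedKernelL1NoWrap`).  ★★★ `exists_green_kernel_l1_le'`.

References: T. Bałaban, CMP 99 (1985) 75–102 [Balaban1985RegularSpaces] ((1.14) p.78, (1.36) p.82); CMP 96 (1984) 223–250 [Balaban1984PropagatorsII] ((1.9) p.226);
CMP 102 (1985) 277–309 [Balaban1985Variational] (Prop. 7 p.299).
-/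

set_option autoImplicit false

noncomputable section

open scoped BigOperators

namespace Summit.QuantumFields.YangMills.Theorems.Prop7PinnedKernelL1NoWrap

open Literature.MathematicalPhysics.QuantumFieldTheory.Balaban1983to89
open Finset LatticeFieldCalculus
open B15DeterminingSets (embIter)
open B5Eq117TorusCarriers (EK)
open Literature.Probability.LatticeModels (torusGreen TorusSite latticeMomentum dispersion)
open Summit.QuantumFields.YangMills.Theorems.Prop7CentreHarmonicInterpKernel (laplace_sub')
open Summit.QuantumFields.YangMills.Theorems.Prop7PinnedKernelL1ExplicitNoWrap (sum_abs_laplace_kernel_le_explicit')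
open Summit.QuantumFields.YangMills.Theorems.Prop7PinnedKernelL1Arith (explicit_le_linear)
open Summit.QuantumFields.YangMills.Theorems.Prop7GreenKernelSiteFree (exists_green_site_split_free)
open Summit.QuantumFields.YangMills.Theorems.Prop7PinnedKernelL1 (abs_torusGreen2_grad_le_of_eq rep_real_of_rep kappa0_rows)

/-- ★★★ **(hK) WITHOUT THE TORUS-SIZE FLOOR** — ✓ `Prop7PinnedKernelL1.exists_green_kernel_l1_le` with `40 ≤ sitesPerDir k` deleted: an absolute `Φ` and, for every run (`d = 3`,
`1 ≤ k ≤ m+K`, `c ≠ 0`) and nontrivial real normed `V`, a matrix `G` with (hG0), (hGrep) and (hK) `Σ_z|c·(Δ_c(G b₊) − Δ_c(G b₋))(z)| ≤ Φ·L^k∕|c|` for every bond.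
[cite: Balaban1985RegularSpaces, (1.36) p.82; Balaban1984PropagatorsII, (1.9) p.226; Balaban1985Variational, Prop. 7 p.299] -/
theorem exists_green_kernel_l1_le' : ∃ Φ : ℝ, ∀ (P : Params) (_ : P.d = 3) (k : ℕ) (_ : k ≤ P.m + P.K) (_ : 1 ≤ k) (c : ℝ) (_ : c ≠ 0) (V : Type) [NormedAddCommGroup V] [NormedSpace ℝ V] [Nontrivial V],
    ∃ G : Site P 0 → Site P 0 → ℝ,
      (∀ x, ∀ y ∈ Set.range (embIter (P := P) k), G x y = 0)
      ∧ (∀ e : SiteField P 0 V, (∀ y ∈ Set.range (embIter (P := P) k), e y = 0) → ∀ x, e x = ∑ z, G x z • laplace c (laplace c e) z)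
      ∧ ∀ b : PBond P 0, ∑ z, |c * (laplace c (G b.tgt) z - laplace c (G b.src) z)| ≤ Φ * (P.L : ℝ) ^ k / |c| := by
  classical
  obtain ⟨CR, CN, CH1, CH, hCR0, hCN0, hCH10, hCH0, hE⟩ := sum_abs_laplace_kernel_le_explicit'
  obtain ⟨C2, hC2⟩ := abs_torusGreen2_grad_le_of_eq
  set CV : ℝ := max C2 0 with hCV
  have hCV0 : 0 ≤ CV := le_max_right _ _
  set κ : ℝ := min (1 / 4) (min (1 / (100 * (2 * Real.sqrt 3 * Real.sqrt (Real.sqrt ((2197 * (24 * 289 * 24576 * 46116) : ℝ))) + 1)))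
      (1 / (50 * (12 * Real.sqrt ((2197 * (24 * 289 * 24576 * 46116) : ℝ)) + 1)))) with hκ
  -- the absolute constant
  refine ⟨9 * Real.exp (20 * κ) * Real.sqrt ((40 * (2 + 9 * Real.pi / (10 * κ))) ^ 3) * (CH + CV)
          + 45 / 8 * Real.exp (20 * κ) * Real.sqrt ((60 * (2 + 9 * Real.pi / (10 * κ))) ^ 3) * Real.sqrt (Real.sqrt (2197 * (24 * 289 * 24576 * 46116))) * CN
          + 243 / 8 * Real.exp (20 * κ) * Real.sqrt ((40 * (2 + 9 * Real.pi / (10 * κ))) ^ 3) * Real.sqrt (2197 * (24 * 289 * 24576 * 46116)) * CH1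
          + (10 * CR + 192000 * (CH + CV))
          + 74088 * 4719 * CV
          + 14157 * Real.exp (21 * κ) * Real.sqrt ((42 * (2 + 9 * Real.pi / (10 * κ))) ^ 3) * CV, ?_⟩
  intro P hd k hk hk1 c hc V _ _ _
  haveI hNZ : NeZero (P.L ^ k * P.sitesPerDir k) := ⟨mul_ne_zero (pow_ne_zero _ P.L_pos.ne') (P.sitesPerDir_ne_zero k)⟩
  obtain ⟨Gf, Uf, G, hsplit, hUC, hG0, hUel, hGf1, hGf2, hGfF, hGrepV⟩ := exists_green_site_split_free (P := P) hk hc (V := V)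
  refine ⟨G, hG0, hGrepV, fun b => ?_⟩
  -- the real representation row
  have hGrep := rep_real_of_rep c _ G hGrepV
  -- the displayed `G₂` and its (R2) row
  obtain ⟨G₂, hG₂'⟩ : ∃ G₂ : TorusSite P.d (P.L ^ k * P.sitesPerDir k) → ℝ, ∀ t,
      G₂ t = (∑ q ∈ (univ : Finset (TorusSite P.d (P.L ^ k * P.sitesPerDir k))).erase 0,
        Real.cos (∑ i, latticeMomentum (P.L ^ k * P.sitesPerDir k) q i * ((t i).val : ℝ))
          / dispersion (latticeMomentum (P.L ^ k * P.sitesPerDir k) q) ^ 2)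
        / (((P.L ^ k * P.sitesPerDir k : ℕ) : ℝ)) ^ P.d := ⟨_, fun t => rfl⟩
  have hV2 : ∀ (i : Fin P.d) (t : TorusSite P.d (P.L ^ k * P.sitesPerDir k)), |G₂ (t + Pi.single i 1) - G₂ t| ≤ CV :=
    fun i t => (hC2 hd (P.L ^ k * P.sitesPerDir k) G₂ hG₂' i t).trans (le_max_left _ _)
  -- scale letters
  have hd3 : (P.d : ℝ) = 3 := by rw [hd]; norm_num
  have hL3 : 3 ≤ P.L := by
    have h1 := P.hL.2; have h2 := P.hL.1
    rcases h2 with ⟨m, hm⟩; omega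
  have hℓ3n : 3 ≤ P.L ^ k := by
    calc 3 ≤ P.L := hL3
      _ = P.L ^ 1 := (pow_one _).symm
      _ ≤ P.L ^ k := Nat.pow_le_pow_right P.L_pos hk1
  have hℓ3 : (3 : ℝ) ≤ (P.L : ℝ) ^ k := by exact_mod_cast hℓ3n
  have hℓ1 : (1 : ℝ) ≤ (P.L : ℝ) ^ k := by linarith
  obtain ⟨hκ0, hκ1, ha, hwin₁, hwin₂⟩ := kappa0_rows (P := P) hd3 hℓ1 hc hκ
  -- the explicit bound at `κ₀`
  have hexp := hE P hd k hk hk1 c hc G₂ hG₂' CV hCV0 hV2 Gf Uf G hsplit hUC hG0 hUel hGf1 hGf2 (hGfF G₂ hG₂') hGrep κ hκ0 hκ1 ha hwin₁ hwin₂ b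
  have hlin := explicit_le_linear (ℓ := (P.L : ℝ) ^ k) (c := c) (κ := κ) (CR := CR) (CN := CN) (CH1 := CH1) (CH := CH) (CV := CV)
    P.d hd hℓ3 hc hκ0 hCR0 hCN0 hCH10 hCH0 hCV0
  have hbound := hexp.trans hlin
  -- the kernel is `c·Δ_c(V − U)`
  have hker : ∀ z, c * (laplace c (G b.tgt) z - laplace c (G b.src) z)
      = c * laplace c (fun x => (Gf b.tgt x - Gf b.src x) - (Uf b.tgt x - Uf b.src x)) z := by
    intro z
    have eT : G b.tgt = fun x => Gf b.tgt x - Uf b.tgt x := funext fun x => hsplit _ x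
    have eS : G b.src = fun x => Gf b.src x - Uf b.src x := funext fun x => hsplit _ x
    have e3 : (fun x => (Gf b.tgt x - Gf b.src x) - (Uf b.tgt x - Uf b.src x)) = fun x => (Gf b.tgt x - Uf b.tgt x) - (Gf b.src x - Uf b.src x) := by
      funext x; ring
    rw [e3, laplace_sub', eT, eS]
  have hca : 0 < |c| := abs_pos.mpr hc
  calc ∑ z, |c * (laplace c (G b.tgt) z - laplace c (G b.src) z)|
      = |c| * ∑ z, |laplace c (fun x => (Gf b.tgt x - Gf b.src x) - (Uf b.tgt x - Uf b.src x)) z| := by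
        rw [Finset.mul_sum]
        exact Finset.sum_congr rfl fun z _ => by rw [hker z, abs_mul]
    _ ≤ |c| * (_ * (P.L : ℝ) ^ k / c ^ 2) := mul_le_mul_of_nonneg_left hbound hca.le
    _ = _ * (P.L : ℝ) ^ k / |c| := by
        have e : c ^ 2 = |c| * |c| := by rw [← sq, sq_abs]
        rw [e]; field_simp

end Summit.QuantumFields.YangMills.Theorems.Prop7PinnedKernelL1NoWrap

end
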